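import Summits.CriticalPhenomena.PercolationContinuityZ3.Theorems.SahiCISNonClosure

/-!
# CIS is not preserved by coordinatewise (non-injective) increasing maps

Cell `prim-sahi`, typer (generation 17); `--supports stmt-CriticalPhenomena-4575`.  No named facts, no sorries.

Müller–Stoyan, *Comparison Methods for Stochastic Models and Risks*, Thm. 3.10.19, lists CIS among the dependence
notions preserved by `X ↦ (f_1(X_1),…,f_n(X_n))` for increasing `f_i` (axiom B4 of Colangelo–Müller–Scarsini 2006).
For NON-INJECTIVE increasing `f_i` this fails for CIS in dimension `3` (it holds for strictly increasing `f_i`, which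
do not change the conditioning σ-algebras, and — by Colangelo–Müller–Scarsini's Thm. 6 / the tree's
`ConditionallyIncreasing.IsCIS.map_pi_monotone` — for their weaker Definition 4): collapsing a conditioning
coordinate merges conditioning atoms exactly as the weak limit of `SahiCISNonClosure.lean` does.

* `collapseMap s x = (min x₀ s, x₁, x₂)` — coordinatewise increasing, measurable;
* `map_collapseMap_fourAtomLaw` — for `s ≤ t`, the image of the CIS law `fourAtomLaw s t` is `fourAtomLaw s s`;
* **`exists_isCISae_map_monotone_not_isCISae`** — a CIS law on `[0,1]³` (kernel sense, everywhere-monotone kernels)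
  and a coordinatewise increasing measurable self-map of `[0,1]³` whose image law is NOT CIS.

References: Müller–Stoyan 2002, Thm. 3.10.19 [MullerStoyan2002]; Colangelo–Müller–Scarsini 2006, §2 (B4), Thm. 6
[ColangeloMullerScarsini2006].  The counterexample is this work.
-/

noncomputable section

namespace Summit.CriticalPhenomena.PercolationContinuityZ3.Theorems.SahiCIS

open MeasureTheory ProbabilityTheory Set Filter Topology Function
open Summit.CriticalPhenomena.PercolationContinuityZ3.Theorems.SahiBoxTP2
open scoped ENNReal unitInterval

/-- The coordinatewise increasing map `(x₀, x₁, x₂) ↦ (min(x₀, s), x₁, x₂)` of `[0,1]³`. [this work] -/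
def collapseMap (s : I) (x : Fin 3 → I) : Fin 3 → I := ![min (x 0) s, x 1, x 2]

/-- `collapseMap s` is coordinatewise increasing. [this work] -/
theorem monotone_collapseMap (s : I) : Monotone (collapseMap s) := by
  intro x y hxy i
  refine Fin.cases ?_ (fun j => ?_) i
  · exact min_le_min (hxy 0) le_rfl
  · refine Fin.cases (hxy 1) (fun k => ?_) j
    exact Fin.cases (hxy 2) (fun l => l.elim0) k

/-- `collapseMap s` is measurable (indeed continuous). [folklore] -/
theorem measurable_collapseMap (s : I) : Measurable (collapseMap s) := by
  refine measurable_pi_iff.2 fun i => ?_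
  refine Fin.cases ?_ (fun j => ?_) i
  · exact (measurable_pi_apply 0).min measurable_const
  · refine Fin.cases (measurable_pi_apply 1) (fun k => ?_) j
    exact Fin.cases (measurable_pi_apply 2) (fun l => l.elim0) k

/-- Values of `collapseMap` on the atoms of `fourAtomLaw`. [this work] -/
theorem collapseMap_vec {s u : I} (hu : s ≤ u) (a b : I) : collapseMap s ![u, a, b] = ![s, a, b] := by
  funext i
  refine Fin.cases ?_ (fun j => ?_) i
  · exact min_eq_right hu
  · refine Fin.cases rfl (fun k => ?_) j
    exact Fin.cases rfl (fun l => l.elim0) k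

/-- **Collapsing the first coordinate maps the CIS law `fourAtomLaw s t` (`s ≤ t`) to `fourAtomLaw s s`.** [this work] -/
theorem map_collapseMap_fourAtomLaw {s t : I} (hst : s ≤ t) :
    (fourAtomLaw s t).map (collapseMap s) = fourAtomLaw s s := by
  simp only [fourAtomLaw, Measure.map_smul, Measure.map_add _ _ (measurable_collapseMap s),
    Measure.map_dirac' (measurable_collapseMap s), collapseMap_vec le_rfl, collapseMap_vec hst]

/-- **CIS is not preserved by coordinatewise increasing maps** (dimension `3`): `fourAtomLaw 0 1` is CIS
(`IsCISae 3`, with everywhere-monotone kernels), `collapseMap 0` is coordinatewise increasing and measurable, and the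
image law `fourAtomLaw 0 0` is not CIS.  (Müller–Stoyan Thm. 3.10.19 for CIS needs strictly increasing maps.)
[this work] -/
theorem exists_isCISae_map_monotone_not_isCISae :
    ∃ (μ : Measure (Fin 3 → I)) (Φ : (Fin 3 → I) → Fin 3 → I), IsProbabilityMeasure μ ∧ IsCISae 3 μ ∧
      Monotone Φ ∧ Measurable Φ ∧ ¬ IsCISae 3 (μ.map Φ) :=
  ⟨fourAtomLaw ⊥ ⊤, collapseMap ⊥, inferInstance, isCISae_fourAtomLaw bot_lt_top, monotone_collapseMap ⊥,
    measurable_collapseMap ⊥, by rw [map_collapseMap_fourAtomLaw bot_le]; exact not_isCISae_fourAtomLaw_self ⊥⟩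

end Summit.CriticalPhenomena.PercolationContinuityZ3.Theorems.SahiCIS

end
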